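import Mathlib
import Literature.Algebra.EuclideanLattices.EllipseResidueClassCounting
import HarnessLib

/-!
# Primitive lattice points of a residue class in an expanding ellipse

Topic `Literature/Algebra/EuclideanLattices` (geometry of numbers). Everything in this file is
PROVED (theorems only); it continues `EllipseResidueClassCounting.lean`.

For a positive definite binary quadratic form `Q = A x₀² + B x₀x₁ + C x₁²` (`A > 0`,
`D = 4AC − B² > 0`), a modulus `q ≥ 1` and a class `ξ ∈ ℤ²` with `gcd(ξ₀, ξ₁, q) = 1`,

  `#{z ∈ ℤ² : z ≡ ξ (mod q), gcd(z₀, z₁) = 1, Q(z) ≤ c} / c ⟶ (2π/(√D q²)) · Σ_{(d,q)=1} μ(d)/d²`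

as `c → ∞` (`tendsto_ncard_coprime_congr_binQF_le_div`). Proof: Möbius inversion of the
condition `gcd = 1` (`card_filter_eq_one_eq_sum_moebius`), the substitution `z = d w`, which maps
the class of `ξ` modulo `q` to that of `d⁻¹ ξ` when `(d, q) = 1` and kills the term otherwise
(`gcd(ξ, q) = 1`), the class-by-class asymptotic `#{w ≡ η : Q(w) ≤ s}/s → 2π/(√D q²)`
(`tendsto_ncard_congr_binQF_le_div`), and Tannery's theorem for the sum over `d` with the
dominating sequence `9/(m d²)`, `m = min(D/4A, D/4C)` (a class meets the ellipse `{Q ≤ s}` in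
at most `9 s/m` non-zero points). This is the classical density `6/π²` of primitive vectors,
refined to congruence classes; it is the lattice-point input of the asymptotic count of rational
points of bounded height on a conic (Browning–Van Valckenborgh 2012, Thm. 1, in
`Literature/NumberTheory/DiophantineGeometry/`).

## References

* H. Davenport, *On a principle of Lipschitz*, J. London Math. Soc. 26 (1951) 179–183
  [Davenport1951] (the counting principle behind `EllipseResidueClassCounting.lean`).
-/

noncomputable section

open Set MeasureTheory Metric Filter Topology
open scoped ArithmeticFunction.Moebius

namespace Literature.Algebra.EuclideanLattices

/-! ## Möbius inversion of the condition `gcd = 1` -/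

/-- `Σ_{d ∣ n} μ(d) = [n = 1]`. [folklore] -/
theorem sum_divisors_moebius_eq_ite (n : ℕ) :
    ∑ d ∈ n.divisors, (μ d : ℤ) = if n = 1 then 1 else 0 := by
  have := congr_arg (fun f : ArithmeticFunction ℤ => f n) ArithmeticFunction.moebius_mul_coe_zeta
  simpa only [ArithmeticFunction.coe_mul_zeta_apply, ArithmeticFunction.one_apply] using this

/-- **Counting by Möbius inversion**: if `0 < g ≤ N` on the finite set `F`, then
`#{z ∈ F : g z = 1} = Σ_{d=1}^{N} μ(d) · #{z ∈ F : d ∣ g z}`. [folklore] -/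
theorem card_filter_eq_one_eq_sum_moebius {α : Type*} (F : Finset α) (g : α → ℕ) (N : ℕ)
    (hg : ∀ z ∈ F, 0 < g z) (hN : ∀ z ∈ F, g z ≤ N) :
    (((F.filter fun z => g z = 1).card : ℕ) : ℤ) =
      ∑ d ∈ Finset.Icc 1 N, (μ d : ℤ) * (((F.filter fun z => d ∣ g z).card : ℕ) : ℤ) := by
  classical
  calc (((F.filter fun z => g z = 1).card : ℕ) : ℤ)
      = ∑ z ∈ F, (if g z = 1 then (1 : ℤ) else 0) := by
        rw [Finset.card_filter]
        push_cast
        rfl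
    _ = ∑ z ∈ F, ∑ d ∈ (g z).divisors, (μ d : ℤ) :=
        Finset.sum_congr rfl fun z _ => (sum_divisors_moebius_eq_ite (g z)).symm
    _ = ∑ d ∈ Finset.Icc 1 N, ∑ _z ∈ F.filter (fun z => d ∣ g z), (μ d : ℤ) := by
        refine Finset.sum_comm' fun z d => ?_
        rw [Finset.mem_filter, Finset.mem_Icc, Nat.mem_divisors]
        constructor
        · rintro ⟨hz, hd, h0⟩
          exact ⟨⟨hz, hd⟩, Nat.pos_of_dvd_of_pos hd (hg z hz),
            (Nat.le_of_dvd (hg z hz) hd).trans (hN z hz)⟩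
        · rintro ⟨⟨hz, hd⟩, -, -⟩
          exact ⟨hz, hd, (hg z hz).ne'⟩
    _ = ∑ d ∈ Finset.Icc 1 N, (μ d : ℤ) * (((F.filter fun z => d ∣ g z).card : ℕ) : ℤ) := by
        refine Finset.sum_congr rfl fun d _ => ?_
        rw [Finset.sum_const, nsmul_eq_mul, mul_comm]

section Coprime

variable {A B C : ℝ} {Q : (Fin 2 → ℝ) → ℝ}

/-! ## Integer points in the ellipse: finiteness and size -/

/-- `intPt (d • w) = d • intPt w`. [folklore] -/
theorem intPt_zsmul (d : ℤ) (w : Fin 2 → ℤ) : intPt (d • w) = (d : ℝ) • intPt w := by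
  funext i
  simp [intPt]

/-- Integer points of the ellipse `{Q ≤ c}` have `|zᵢ| ≤ ⌊√(c/m)⌋`. [folklore] -/
theorem natAbs_le_floor_of_binQF_le
    (hQ : ∀ x, Q x = A * x 0 ^ 2 + B * (x 0 * x 1) + C * x 1 ^ 2)
    (hA : 0 < A) (hD : 0 < 4 * A * C - B ^ 2) {z : Fin 2 → ℤ} {c : ℝ} (hz : Q (intPt z) ≤ c)
    (i : Fin 2) :
    (z i).natAbs ≤ ⌊Real.sqrt (c / min ((4 * A * C - B ^ 2) / (4 * A))
      ((4 * A * C - B ^ 2) / (4 * C)))⌋₊ := by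
  apply Nat.le_floor
  have h := abs_coord_le_of_binQF_le hQ hA hD hz i
  rw [intPt_apply] at h
  rw [Nat.cast_natAbs, Int.cast_abs]
  exact h

/-- The integer points of a residue class in the ellipse form a finite set. [folklore] -/
theorem finite_congr_binQF_le
    (hQ : ∀ x, Q x = A * x 0 ^ 2 + B * (x 0 * x 1) + C * x 1 ^ 2)
    (hA : 0 < A) (hD : 0 < 4 * A * C - B ^ 2) (q : ℕ) (ξ : Fin 2 → ℤ) (c : ℝ) :
    {z : Fin 2 → ℤ | (∀ i, (q : ℤ) ∣ z i - ξ i) ∧ Q (intPt z) ≤ c}.Finite :=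
  (finite_setOf_intPt_mem (S := {x | Q x ≤ c}) (isBounded_binQF_le hQ hA hD c)).subset
    fun _ hz => hz.2

/-- A non-zero integer point of `{Q ≤ s}` forces `m ≤ s`, `m = min(D/4A, D/4C)`. [folklore] -/
theorem min_le_of_binQF_le_of_ne_zero
    (hQ : ∀ x, Q x = A * x 0 ^ 2 + B * (x 0 * x 1) + C * x 1 ^ 2)
    (hA : 0 < A) (hD : 0 < 4 * A * C - B ^ 2) {w : Fin 2 → ℤ} {s : ℝ} (hw : w ≠ 0)
    (hs : Q (intPt w) ≤ s) :
    min ((4 * A * C - B ^ 2) / (4 * A)) ((4 * A * C - B ^ 2) / (4 * C)) ≤ s := by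
  obtain ⟨i, hi⟩ : ∃ i, w i ≠ 0 := by
    by_contra h
    push Not at h
    exact hw (funext h)
  have h1 : (1 : ℝ) ≤ (intPt w i) ^ 2 := by
    rw [intPt_apply, ← Int.cast_pow, ← Int.cast_one, Int.cast_le]
    nlinarith [Int.one_le_abs hi, sq_abs (w i)]
  have h2 := binQF_coord_sq_le hQ hA hD (intPt w) i
  nlinarith [binQF_min_pos hA hD]

/-- **Crude bound**: a residue class has at most `9 s/m` non-zero points in `{Q ≤ s}` (`s > 0`).
[folklore] -/
theorem ncard_congr_ne_zero_binQF_le_le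
    (hQ : ∀ x, Q x = A * x 0 ^ 2 + B * (x 0 * x 1) + C * x 1 ^ 2)
    (hA : 0 < A) (hD : 0 < 4 * A * C - B ^ 2) {q : ℕ} (hq : 0 < q) (η : Fin 2 → ℤ) {s : ℝ}
    (hs : 0 < s) :
    (({w : Fin 2 → ℤ | (∀ i, (q : ℤ) ∣ w i - η i) ∧ w ≠ 0 ∧ Q (intPt w) ≤ s}.ncard : ℕ) : ℝ) ≤
      9 * s / min ((4 * A * C - B ^ 2) / (4 * A)) ((4 * A * C - B ^ 2) / (4 * C)) := by
  set m := min ((4 * A * C - B ^ 2) / (4 * A)) ((4 * A * C - B ^ 2) / (4 * C)) with hm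
  have hm0 : 0 < m := binQF_min_pos hA hD
  set N : Set (Fin 2 → ℤ) := {w | (∀ i, (q : ℤ) ∣ w i - η i) ∧ w ≠ 0 ∧ Q (intPt w) ≤ s} with hN
  rcases N.eq_empty_or_nonempty with hN0 | ⟨w₀, hw₀⟩
  · rw [hN0, Set.ncard_empty, Nat.cast_zero]
    positivity
  have hms : m ≤ s := min_le_of_binQF_le_of_ne_zero hQ hA hD hw₀.2.1 hw₀.2.2
  set R := Real.sqrt (s / m) with hR
  have hR1 : 1 ≤ R := by
    rw [hR, Real.le_sqrt (by norm_num) (by positivity), one_pow, le_div_iff₀ hm0, one_mul]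
    exact hms
  have hsub : N ⊆ {z : Fin 2 → ℤ | (∀ i, (q : ℤ) ∣ z i - η i) ∧ intPt z ∈ {x | Q x ≤ s}} :=
    fun w hw => ⟨hw.1, hw.2.2⟩
  have hfin := finite_congr_binQF_le hQ hA hD q η s
  have h1 : (N.ncard : ℝ) ≤ ({z : Fin 2 → ℤ | (∀ i, (q : ℤ) ∣ z i - η i) ∧
      intPt z ∈ {x | Q x ≤ s}}.ncard : ℝ) := by
    exact_mod_cast Set.ncard_le_ncard hsub hfin
  have h2 := ncard_congr_le_of_subset_box (S := {x | Q x ≤ s}) (fun _ => -R) (fun _ => R)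
    (fun _ => by linarith) (fun x hx i => abs_le.1 (abs_coord_le_of_binQF_le hQ hA hD hx i)) hq η
  refine h1.trans (h2.trans ?_)
  rw [Fin.prod_univ_two, show R - -R = 2 * R by ring]
  have hq1 : (1 : ℝ) ≤ q := by exact_mod_cast hq
  have hq0 : (0 : ℝ) < q := by linarith
  have h3 : 2 * R / q + 1 ≤ 3 * R := by
    rw [div_add_one hq0.ne', div_le_iff₀ hq0]
    nlinarith
  have h4 : 0 ≤ 2 * R / q + 1 := by positivity
  calc (2 * R / q + 1) * (2 * R / q + 1) ≤ (3 * R) * (3 * R) :=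
        mul_le_mul h3 h3 h4 (by positivity)
    _ = 9 * R ^ 2 := by ring
    _ = 9 * s / m := by rw [hR, Real.sq_sqrt (by positivity)]; ring

/-- **Density of a residue class, non-zero points**: removing `w = 0` does not change the limit
`#{w ≡ η : Q(w) ≤ s}/s → 2π/(√D q²)`. [folklore] -/
theorem tendsto_ncard_congr_ne_zero_binQF_le_div
    (hQ : ∀ x, Q x = A * x 0 ^ 2 + B * (x 0 * x 1) + C * x 1 ^ 2)
    (hA : 0 < A) (hD : 0 < 4 * A * C - B ^ 2) {q : ℕ} (hq : 0 < q) (η : Fin 2 → ℤ) :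
    Tendsto (fun s : ℝ =>
      (({w : Fin 2 → ℤ | (∀ i, (q : ℤ) ∣ w i - η i) ∧ w ≠ 0 ∧ Q (intPt w) ≤ s}.ncard : ℕ) : ℝ) / s)
      atTop (𝓝 (2 * Real.pi / Real.sqrt (4 * A * C - B ^ 2) / (q : ℝ) ^ 2)) := by
  set κ := 2 * Real.pi / Real.sqrt (4 * A * C - B ^ 2) / (q : ℝ) ^ 2
  have hall := tendsto_ncard_congr_binQF_le_div hQ hA hD hq η
  have hset : ∀ s : ℝ, {w : Fin 2 → ℤ | (∀ i, (q : ℤ) ∣ w i - η i) ∧ w ≠ 0 ∧ Q (intPt w) ≤ s} =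
      {w : Fin 2 → ℤ | (∀ i, (q : ℤ) ∣ w i - η i) ∧ Q (intPt w) ≤ s} \ {0} := by
    intro s
    ext w
    simp only [Set.mem_sdiff, Set.mem_setOf_eq, Set.mem_singleton_iff]
    tauto
  have hlow : Tendsto (fun s : ℝ =>
      (({w : Fin 2 → ℤ | (∀ i, (q : ℤ) ∣ w i - η i) ∧ Q (intPt w) ≤ s}.ncard : ℕ) : ℝ) / s - 1 / s)
      atTop (𝓝 κ) := by
    have := hall.sub (tendsto_const_nhds.div_atTop tendsto_id : Tendsto (fun s : ℝ => (1 : ℝ) / s)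
      atTop (𝓝 0))
    rwa [sub_zero] at this
  refine tendsto_of_tendsto_of_tendsto_of_le_of_le' hlow hall ?_ ?_
  · filter_upwards [eventually_gt_atTop 0] with s hs
    rw [← sub_div, div_le_div_iff_of_pos_right hs, hset s, sub_le_iff_le_add]
    have h := Set.pred_ncard_le_ncard_sdiff_singleton
      {w : Fin 2 → ℤ | (∀ i, (q : ℤ) ∣ w i - η i) ∧ Q (intPt w) ≤ s} 0
    have h' : ({w : Fin 2 → ℤ | (∀ i, (q : ℤ) ∣ w i - η i) ∧ Q (intPt w) ≤ s}.ncard : ℝ) - 1 ≤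
        (({w : Fin 2 → ℤ | (∀ i, (q : ℤ) ∣ w i - η i) ∧ Q (intPt w) ≤ s} \ {0}).ncard : ℝ) := by
      have h2 := (tsub_le_iff_right.1 h)
      have h3 : ({w : Fin 2 → ℤ | (∀ i, (q : ℤ) ∣ w i - η i) ∧ Q (intPt w) ≤ s}.ncard : ℝ) ≤
          (({w : Fin 2 → ℤ | (∀ i, (q : ℤ) ∣ w i - η i) ∧ Q (intPt w) ≤ s} \ {0}).ncard : ℝ) + 1 := by
        exact_mod_cast h2
      linarith
    linarith
  · filter_upwards [eventually_gt_atTop 0] with s hs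
    rw [div_le_div_iff_of_pos_right hs, hset s]
    exact_mod_cast Set.ncard_sdiff_singleton_le _ _

/-! ## The substitution `z = d w` -/

/-- **The substitution `z = d w` in a residue class**: for `(d, q) = 1` and `d η ≡ ξ (mod q)`,
multiplication by `d` is a bijection from the non-zero points `w ≡ η (mod q)` with
`Q(w) ≤ c/d²` onto the non-zero points `z ≡ ξ (mod q)` with `d ∣ z` and `Q(z) ≤ c`. [folklore] -/
theorem setOf_congr_dvd_binQF_le_eq_image
    (hQ : ∀ x, Q x = A * x 0 ^ 2 + B * (x 0 * x 1) + C * x 1 ^ 2)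
    {q : ℕ} {ξ η : Fin 2 → ℤ} {d : ℕ} (hd : 0 < d) (hdq : d.Coprime q)
    (hη : ∀ i, (q : ℤ) ∣ d * η i - ξ i) (c : ℝ) :
    {z : Fin 2 → ℤ | (∀ i, (q : ℤ) ∣ z i - ξ i) ∧ z ≠ 0 ∧ (∀ i, (d : ℤ) ∣ z i) ∧
        Q (intPt z) ≤ c} =
      (fun w => (d : ℤ) • w) ''
        {w : Fin 2 → ℤ | (∀ i, (q : ℤ) ∣ w i - η i) ∧ w ≠ 0 ∧ Q (intPt w) ≤ c / (d : ℝ) ^ 2} := by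
  have hd0 : (d : ℤ) ≠ 0 := by exact_mod_cast hd.ne'
  have hdR : (0 : ℝ) < d := by exact_mod_cast hd
  have hcop : IsCoprime (q : ℤ) (d : ℤ) := (Nat.isCoprime_iff_coprime.2 hdq).symm
  ext z
  simp only [Set.mem_setOf_eq, Set.mem_image]
  constructor
  · rintro ⟨hzξ, hz0, hdz, hzc⟩
    refine ⟨fun i => z i / d, ⟨fun i => ?_, ?_, ?_⟩, ?_⟩
    · have h1 : (q : ℤ) ∣ (d : ℤ) * (z i / d - η i) := by
        rw [mul_sub, Int.mul_ediv_cancel' (hdz i)]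
        have := Int.dvd_sub (hzξ i) (hη i)
        rwa [sub_sub_sub_cancel_right] at this
      exact hcop.dvd_of_dvd_mul_left h1
    · intro h
      apply hz0
      funext i
      have := congrFun h i
      simp only [Pi.zero_apply] at this
      rw [← Int.mul_ediv_cancel' (hdz i), this, mul_zero, Pi.zero_apply]
    · have hz : z = (d : ℤ) • fun i => z i / d := by
        funext i; simp [Int.mul_ediv_cancel' (hdz i)]
      rw [hz, intPt_zsmul, binQF_smul hQ] at hzc
      rwa [le_div_iff₀ (by positivity), mul_comm]
    · funext i
      simp [Int.mul_ediv_cancel' (hdz i)]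
  · rintro ⟨w, ⟨hwη, hw0, hwc⟩, rfl⟩
    refine ⟨fun i => ?_, ?_, fun i => ⟨w i, by simp⟩, ?_⟩
    · have h1 : (q : ℤ) ∣ (d : ℤ) * (w i - η i) + ((d : ℤ) * η i - ξ i) :=
        Int.dvd_add (Dvd.dvd.mul_left (hwη i) _) (hη i)
      have e : ((d : ℤ) • w) i - ξ i = (d : ℤ) * (w i - η i) + ((d : ℤ) * η i - ξ i) := by
        simp only [Pi.smul_apply, smul_eq_mul]; ring
      rwa [e]
    · intro h
      exact hw0 (smul_right_injective (Fin 2 → ℤ) hd0 (by simpa using h))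
    · rw [intPt_zsmul, binQF_smul hQ]
      rwa [le_div_iff₀ (by positivity), mul_comm] at hwc

/-- If `(d, q) > 1` and `gcd(ξ₀, ξ₁, q) = 1`, no `z ≡ ξ (mod q)` is divisible by `d`. [folklore] -/
theorem setOf_congr_dvd_eq_empty {q : ℕ} {ξ : Fin 2 → ℤ} (hξ : Nat.Coprime (Int.gcd (ξ 0) (ξ 1)) q)
    {d : ℕ} (hdq : ¬d.Coprime q) (P : (Fin 2 → ℤ) → Prop) :
    {z : Fin 2 → ℤ | (∀ i, (q : ℤ) ∣ z i - ξ i) ∧ P z ∧ (∀ i, (d : ℤ) ∣ z i)} = ∅ := by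
  obtain ⟨p, hp, hpd, hpq⟩ := Nat.Prime.not_coprime_iff_dvd.1 hdq
  ext z
  simp only [Set.mem_setOf_eq, Set.mem_empty_iff_false, iff_false, not_and]
  intro hzξ _ hdz
  have hpξ : ∀ i, (p : ℤ) ∣ ξ i := fun i => by
    have h1 : (p : ℤ) ∣ z i := (Int.natCast_dvd_natCast.2 hpd).trans (hdz i)
    have h2 : (p : ℤ) ∣ z i - ξ i := (Int.natCast_dvd_natCast.2 hpq).trans (hzξ i)
    have := Int.dvd_sub h1 h2
    rwa [sub_sub_cancel] at this
  have h3 : p ∣ Int.gcd (ξ 0) (ξ 1) := Int.dvd_gcd (hpξ 0) (hpξ 1)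
  have h4 : p ∣ Nat.gcd (Int.gcd (ξ 0) (ξ 1)) q := Nat.dvd_gcd h3 hpq
  rw [hξ] at h4
  exact hp.not_dvd_one h4

/-! ## The main theorem -/

/-- **Primitive lattice points of a residue class in an expanding ellipse.** For a positive
definite form `Q = A x₀² + B x₀x₁ + C x₁²` (`A > 0`, `D = 4AC − B² > 0`), `q ≥ 1` and `ξ ∈ ℤ²`
with `gcd(ξ₀, ξ₁, q) = 1`,
`#{z ∈ ℤ² : z ≡ ξ (mod q), gcd(z₀, z₁) = 1, Q(z) ≤ c} / c → (2π/(√D q²)) Σ_{(d,q)=1} μ(d)/d²`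
as `c → ∞`. [folklore] -/
theorem tendsto_ncard_coprime_congr_binQF_le_div
    (hQ : ∀ x, Q x = A * x 0 ^ 2 + B * (x 0 * x 1) + C * x 1 ^ 2)
    (hA : 0 < A) (hD : 0 < 4 * A * C - B ^ 2) {q : ℕ} (hq : 0 < q) {ξ : Fin 2 → ℤ}
    (hξ : Nat.Coprime (Int.gcd (ξ 0) (ξ 1)) q) :
    Tendsto (fun c : ℝ =>
      (({z : Fin 2 → ℤ | (∀ i, (q : ℤ) ∣ z i - ξ i) ∧ Int.gcd (z 0) (z 1) = 1 ∧
          Q (intPt z) ≤ c}.ncard : ℕ) : ℝ) / c) atTop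
      (𝓝 (2 * Real.pi / Real.sqrt (4 * A * C - B ^ 2) / (q : ℝ) ^ 2 *
        ∑' d : ℕ, if d.Coprime q then (μ d : ℝ) / (d : ℝ) ^ 2 else 0)) := by
  classical
  set m := min ((4 * A * C - B ^ 2) / (4 * A)) ((4 * A * C - B ^ 2) / (4 * C)) with hm
  have hm0 : 0 < m := binQF_min_pos hA hD
  set κ := 2 * Real.pi / Real.sqrt (4 * A * C - B ^ 2) / (q : ℝ) ^ 2 with hκ
  -- representatives `η d` of `d⁻¹ ξ (mod q)`
  have hη : ∀ d : ℕ, ∃ η : Fin 2 → ℤ, d.Coprime q → ∀ i, (q : ℤ) ∣ d * η i - ξ i := by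
    intro d
    by_cases h : d.Coprime q
    · obtain ⟨e, he⟩ := Int.mod_coprime h
      refine ⟨fun i => e * ξ i, fun _ i => ?_⟩
      have h1 : (q : ℤ) ∣ 1 - d * e := he.dvd
      have e1 : (d : ℤ) * (e * ξ i) - ξ i = -((1 - d * e) * ξ i) := by ring
      rw [e1]
      exact (h1.mul_right _).neg_right
    · exact ⟨0, fun h' => absurd h' h⟩
  choose η hη using hη
  -- the counting functions
  set Ncnt : ℕ → ℝ → ℕ := fun d s =>
    {w : Fin 2 → ℤ | (∀ i, (q : ℤ) ∣ w i - η d i) ∧ w ≠ 0 ∧ Q (intPt w) ≤ s}.ncard with hNcnt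
  set f : ℝ → ℕ → ℝ := fun c d =>
    (μ d : ℝ) * if d.Coprime q ∧ 0 < d then (Ncnt d (c / (d : ℝ) ^ 2) : ℝ) / c else 0 with hf
  set g : ℕ → ℝ := fun d => (μ d : ℝ) * if d.Coprime q ∧ 0 < d then κ / (d : ℝ) ^ 2 else 0
    with hg
  set bound : ℕ → ℝ := fun d => 9 / m * (1 / (d : ℝ) ^ 2) with hbound
  -- (i) summable bound
  have h_sum : Summable bound := (Real.summable_one_div_nat_pow.2 one_lt_two).mul_left _
  -- (ii) pointwise limits
  have hab : ∀ d, Tendsto (f · d) atTop (𝓝 (g d)) := by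
    intro d
    by_cases hd : d.Coprime q ∧ 0 < d
    · simp only [hf, hg, if_pos hd]
      refine Tendsto.const_mul _ ?_
      have hdR : (0 : ℝ) < d := by exact_mod_cast hd.2
      have hd2 : (d : ℝ) ^ 2 ≠ 0 := by positivity
      have h1 : Tendsto (fun s : ℝ => (Ncnt d s : ℝ) / s) atTop (𝓝 κ) :=
        tendsto_ncard_congr_ne_zero_binQF_le_div hQ hA hD hq (η d)
      have h2 := (h1.comp (tendsto_id.atTop_div_const (pow_pos hdR 2))).div_const ((d : ℝ) ^ 2)
      refine h2.congr' (Eventually.of_forall fun c => ?_)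
      simp only [Function.comp_apply, id]
      rw [div_div, div_mul_cancel₀ c hd2]
    · simp only [hf, hg, if_neg hd]
      exact tendsto_const_nhds
  -- (iii) domination
  have h_bound : ∀ᶠ c in atTop, ∀ d, ‖f c d‖ ≤ bound d := by
    filter_upwards [eventually_gt_atTop 0] with c hc d
    by_cases hd : d.Coprime q ∧ 0 < d
    · have hdR : (0 : ℝ) < d := by exact_mod_cast hd.2
      simp only [hf, hbound, if_pos hd, Real.norm_eq_abs, abs_mul]
      have h1 : |(μ d : ℝ)| ≤ 1 := by exact_mod_cast ArithmeticFunction.abs_moebius_le_one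
      have h2 : 0 ≤ (Ncnt d (c / (d : ℝ) ^ 2) : ℝ) / c := by positivity
      have h3 : (Ncnt d (c / (d : ℝ) ^ 2) : ℝ) / c ≤ 9 / m * (1 / (d : ℝ) ^ 2) := by
        rw [div_le_iff₀ hc]
        have := ncard_congr_ne_zero_binQF_le_le hQ hA hD hq (η d) (s := c / (d : ℝ) ^ 2)
          (by positivity)
        refine this.trans (le_of_eq ?_)
        rw [← hm]
        field_simp
      rw [abs_of_nonneg h2]
      calc |(μ d : ℝ)| * ((Ncnt d (c / (d : ℝ) ^ 2) : ℝ) / c) ≤ 1 * (9 / m * (1 / (d : ℝ) ^ 2)) :=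
            mul_le_mul h1 h3 h2 zero_le_one
        _ = 9 / m * (1 / (d : ℝ) ^ 2) := one_mul _
    · simp only [hf, hbound, if_neg hd, mul_zero, norm_zero]
      positivity
  have hT := tendsto_tsum_of_dominated_convergence h_sum hab h_bound
  -- (iv) the limit
  have hlim : ∑' d, g d = κ * ∑' d : ℕ, if d.Coprime q then (μ d : ℝ) / (d : ℝ) ^ 2 else 0 := by
    rw [← tsum_mul_left]
    refine tsum_congr fun d => ?_
    simp only [hg]
    by_cases h1 : d.Coprime q
    · by_cases h2 : 0 < d
      · rw [if_pos ⟨h1, h2⟩, if_pos h1]; ring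
      · have : d = 0 := by omega
        subst this
        simp
    · rw [if_neg (fun h => h1 h.1), if_neg h1]; ring
  rw [← hlim]
  -- (v) the Möbius identity, for every `c > 0`
  refine hT.congr' ?_
  filter_upwards [eventually_gt_atTop 0] with c hc
  set R := ⌊Real.sqrt (c / m)⌋₊ with hR
  -- the finite set `F` of non-zero `z ≡ ξ` in the ellipse, and `gcd` on it
  have hFfin : {z : Fin 2 → ℤ | (∀ i, (q : ℤ) ∣ z i - ξ i) ∧ z ≠ 0 ∧ Q (intPt z) ≤ c}.Finite :=
    (finite_congr_binQF_le hQ hA hD q ξ c).subset fun z hz => ⟨hz.1, hz.2.2⟩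
  set F := hFfin.toFinset with hF
  set gfun : (Fin 2 → ℤ) → ℕ := fun z => Int.gcd (z 0) (z 1) with hgfun
  have hmemF : ∀ z, z ∈ F ↔ (∀ i, (q : ℤ) ∣ z i - ξ i) ∧ z ≠ 0 ∧ Q (intPt z) ≤ c := fun z => by
    rw [hF, Set.Finite.mem_toFinset]; rfl
  have hgpos : ∀ z ∈ F, 0 < gfun z := by
    intro z hz
    rw [hmemF] at hz
    rw [hgfun, Int.gcd_pos_iff]
    by_contra h
    push Not at h
    apply hz.2.1
    funext i
    fin_cases i
    · exact h.1
    · exact h.2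
  have hgle : ∀ z ∈ F, gfun z ≤ R := by
    intro z hz
    have hz' := (hmemF z).1 hz
    have hb := fun i => natAbs_le_floor_of_binQF_le hQ hA hD hz'.2.2 i
    rw [← hm, ← hR] at hb
    show Int.gcd (z 0) (z 1) ≤ R
    rw [Int.gcd_eq_natAbs]
    by_cases h0 : z 0 = 0
    · have h1 : z 1 ≠ 0 := fun h1 => hz'.2.1 (by funext i; fin_cases i <;> assumption)
      rw [h0, Int.natAbs_zero, Nat.gcd_zero_left]
      exact hb 1
    · exact (Nat.gcd_le_left _ (Int.natAbs_pos.2 h0)).trans (hb 0)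
  have hmoeb := card_filter_eq_one_eq_sum_moebius F gfun R hgpos hgle
  -- identify the left side
  have hS : {z : Fin 2 → ℤ | (∀ i, (q : ℤ) ∣ z i - ξ i) ∧ Int.gcd (z 0) (z 1) = 1 ∧
      Q (intPt z) ≤ c} = ↑(F.filter fun z => gfun z = 1) := by
    ext z
    rw [Finset.coe_filter, Set.mem_setOf_eq, Set.mem_setOf_eq, hmemF]
    constructor
    · rintro ⟨h1, h2, h3⟩
      refine ⟨⟨h1, ?_, h3⟩, h2⟩
      rintro rfl
      simp at h2
    · rintro ⟨⟨h1, -, h3⟩, h2⟩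
      exact ⟨h1, h2, h3⟩
  -- identify the terms
  have hterm : ∀ d ∈ Finset.Icc 1 R,
      (((F.filter fun z => d ∣ gfun z).card : ℕ) : ℝ) =
        if d.Coprime q ∧ 0 < d then (Ncnt d (c / (d : ℝ) ^ 2) : ℝ) else 0 := by
    intro d hd
    rw [Finset.mem_Icc] at hd
    have hset : (↑(F.filter fun z => d ∣ gfun z) : Set (Fin 2 → ℤ)) =
        {z : Fin 2 → ℤ | (∀ i, (q : ℤ) ∣ z i - ξ i) ∧ (z ≠ 0 ∧ Q (intPt z) ≤ c) ∧
          (∀ i, (d : ℤ) ∣ z i)} := by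
      ext z
      rw [Finset.coe_filter, Set.mem_setOf_eq, Set.mem_setOf_eq, hmemF, hgfun]
      simp only
      constructor
      · rintro ⟨⟨h1, h2, h3⟩, h4⟩
        refine ⟨h1, ⟨h2, h3⟩, fun i => ?_⟩
        have h5 : ((d : ℕ) : ℤ) ∣ (Int.gcd (z 0) (z 1) : ℤ) := Int.natCast_dvd_natCast.2 h4
        fin_cases i
        · exact h5.trans (Int.gcd_dvd_left _ _)
        · exact h5.trans (Int.gcd_dvd_right _ _)
      · rintro ⟨h1, ⟨h2, h3⟩, h4⟩
        exact ⟨⟨h1, h2, h3⟩, Int.dvd_gcd (h4 0) (h4 1)⟩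
    rw [← Set.ncard_coe_finset, hset]
    by_cases hdq : d.Coprime q
    · rw [if_pos ⟨hdq, hd.1⟩]
      have e := setOf_congr_dvd_binQF_le_eq_image hQ hd.1 hdq (hη d hdq) c
      have hset2 : {z : Fin 2 → ℤ | (∀ i, (q : ℤ) ∣ z i - ξ i) ∧ (z ≠ 0 ∧ Q (intPt z) ≤ c) ∧
          (∀ i, (d : ℤ) ∣ z i)} = {z : Fin 2 → ℤ | (∀ i, (q : ℤ) ∣ z i - ξ i) ∧ z ≠ 0 ∧
          (∀ i, (d : ℤ) ∣ z i) ∧ Q (intPt z) ≤ c} := by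
        ext z; simp only [Set.mem_setOf_eq]; tauto
      rw [hset2, e, Set.ncard_image_of_injective _
        (smul_right_injective (Fin 2 → ℤ)
          (by exact_mod_cast Nat.one_le_iff_ne_zero.1 hd.1 : (d : ℤ) ≠ 0))]
    · rw [if_neg (fun h => hdq h.1), setOf_congr_dvd_eq_empty hξ hdq, Set.ncard_empty,
        Nat.cast_zero]
  -- terms beyond `R` vanish
  have hvanish : ∀ d ∉ Finset.Icc 1 R, f c d = 0 := by
    intro d hd
    rw [Finset.mem_Icc, not_and_or, not_le, not_le] at hd
    simp only [hf]
    by_cases hd' : d.Coprime q ∧ 0 < d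
    · rw [if_pos hd']
      rcases hd with hd | hd
      · omega
      · suffices h : Ncnt d (c / (d : ℝ) ^ 2) = 0 by rw [h, Nat.cast_zero, zero_div, mul_zero]
        rw [hNcnt, Set.ncard_eq_zero (hs := ?_)]
        · rw [Set.eq_empty_iff_forall_notMem]
          rintro w ⟨-, hw0, hwc⟩
          have hdR : (0 : ℝ) < d := by exact_mod_cast hd'.2
          have hms := min_le_of_binQF_le_of_ne_zero hQ hA hD hw0 hwc
          rw [← hm, le_div_iff₀ (by positivity)] at hms
          have : (d : ℝ) ≤ Real.sqrt (c / m) := by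
            rw [Real.le_sqrt hdR.le (by positivity), le_div_iff₀ hm0]
            linarith
          have : d ≤ R := Nat.le_floor this
          omega
        · exact (finite_congr_binQF_le hQ hA hD q (η d) _).subset fun w hw => ⟨hw.1, hw.2.2⟩
    · rw [if_neg hd', mul_zero]
  -- assemble
  rw [tsum_eq_sum (s := Finset.Icc 1 R) hvanish, hS, Set.ncard_coe_finset]
  have hmoebR : (((F.filter fun z => gfun z = 1).card : ℕ) : ℝ) =
      ∑ d ∈ Finset.Icc 1 R, (μ d : ℝ) * (((F.filter fun z => d ∣ gfun z).card : ℕ) : ℝ) := by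
    exact_mod_cast hmoeb
  rw [hmoebR, Finset.sum_div]
  refine Finset.sum_congr rfl fun d hd => ?_
  rw [hterm d hd]
  simp only [hf]
  have hd' : 0 < d := (Finset.mem_Icc.1 hd).1
  by_cases hdq : d.Coprime q
  · rw [if_pos ⟨hdq, hd'⟩, if_pos ⟨hdq, hd'⟩, mul_div_assoc]
  · rw [if_neg (fun h => hdq h.1), if_neg (fun h => hdq h.1), mul_zero, zero_div]

end Coprime

end Literature.Algebra.EuclideanLattices
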